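import Summits.NavierStokesRegularity.TurbBounds.FSU1.Cells1
import Summits.NavierStokesRegularity.TurbBounds.FSU1.Cells2
import Summits.NavierStokesRegularity.TurbBounds.FSU1.Cells3
import Summits.NavierStokesRegularity.TurbBounds.FSU1.Cells4

/-!
HONEST FRAMING: rigorous bounds for the stated PDE and boundary conditions; no claim about physical turbulence beyond the bound.
(FS-U1″ finite part in Lean; producer pub-turb-sos gen 19; STAGED.)
-/

set_option linter.style.longLine false
set_option autoImplicit false

namespace Summit.NavierStokesRegularity.TurbBounds.FSU1

/-- All 481 cells, in order. -/
def cells : List Row := cells1 ++ cells2 ++ cells3 ++ cells4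

/-- Kernel evaluation (`decide +kernel`): the concatenated table passes `coverCheck p0` (first `κa = 0`, matching endpoints, last `κb = κ_I`). -/
theorem cells_cover_check : coverCheck p0 cells = true := by
  decide +kernel

/-- (A_cell) holds on every cell of the table. -/
theorem cells_ok : ∀ r ∈ cells, CellIneq p0 r.ka r.kb r.eps := by
  intro r hr
  simp only [cells, List.mem_append] at hr
  rcases hr with ((hr | hr) | hr) | hr
  · exact cells1_ok r hr
  · exact cells2_ok r hr
  · exact cells3_ok r hr
  · exact cells4_ok r hr

/-- The cells cover `[0, κ_I]`. -/
theorem cells_cover : ∀ κ : ℝ, 0 ≤ κ → κ ≤ (p0.kapI : ℝ) → ∃ s ∈ cells, (s.ka : ℝ) ≤ κ ∧ κ ≤ (s.kb : ℝ) :=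
  cover_of_check cells_cover_check

end Summit.NavierStokesRegularity.TurbBounds.FSU1
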